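import Mathlib
import HarnessLib
import Summits.HubbardSuperconductivity.HubbardSuperconductivity.Theorems.KLProgrammeKLRegimeEngineOverlapMeanFreeTelRegime
import Summits.HubbardSuperconductivity.HubbardSuperconductivity.Theorems.KLProgrammeKLRegimeOverlapWtTower
import Summits.HubbardSuperconductivity.HubbardSuperconductivity.Theorems.KLProgrammeKLRegimeOverlapWtColFlowDeep
import Summits.HubbardSuperconductivity.HubbardSuperconductivity.Theorems.KLProgrammeKLRegimeAlphaWtFlowAllReg

/-!
# K3 ENGINE child (stmt-HubbardSuperconductivity-20437), stub (b), the LEVELS package (ℓ): **the weighted overlap constants `cr/cc` AT THE FLOW FRAME `K_n`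
# WITH NO DEPTH WINDOW** — the window-free twins of p3's `overlapWt_towerBlock_klEng_flow_deep` / `overlapWt_towerBlockCol_klEng_flow_deep` at E1's convention
# (thin `J′ = dk`, fat `dk − 1`), brick (W5) of the «(F1)-JOIN+W2» cure

Cell `gate-hubbard-kl`, seat hubbard-kl-k3c3-p2 (g12); F1-W2-DESIGN §2 (W5).  As for `α` (…AlphaWtFlowAll): on the deep window `4ⁿ·U ≤ 4^{2dk+5}` p3's
constants; below it the (W4) overlap telescope `overlapWt_rows_cols_klEng_meanFreeFinal 5 R c″` from the base index `m₀ := Nat.findGreatest (4^{·}·U ≤ 4^{2dk+5}) n`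
(`exists_overlap_base_index_of_not_window`: `1 ≤ m₀ ≤ n`, `2dk+5 ≤ m₀`, the base window), read at `K_n` through the model congruence (`klAnisoFamily_congr`,
`nambuXiCT_congr` with `eval_fsub_symInterp_sum_Ico_self`) and at any weaker rate `jw ≥ dk` (`klScaleWt_le_of_le`):

* **`overlapWt_towerBlock_klEng_flow_all (d) (R) (c″)`** — `∃ C_J > 0`: stub-(b) binders + `c″U ≤ 1`, `IsKLRegime U cc (−n)`, the REGISTERED (K5′) clauses
  `∀ m, 1 ≤ m → m < n → FlowPieceOscAt … c″ … m`, for every block with `1 ≤ dk ≤ n` and every rate `jw ≥ dk`: E1's `hrow′` (rows `≤ 81·C_J·M/β`) AND `hcol′`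
  (full columns `≤ 81·2^{dk−(dk−1)}·C_J·M/β`) of `E(F_{dk}[K_n])·S(F̃_{dk−1}[K_n])` — NO window.  Thin scale `J′ > dk` on ask (design memo §4).

Everything is proved; no definitions; nothing about the model is asserted beyond the landed theorems; nothing asserts superconductivity.
[cite: BenfattoGiulianiMastropietro2006, §2.7 (2.71a), §2.8 (2.77), (2.82)–(2.83), §3 (3.2)–(3.8)]
-/

noncomputable section

namespace Summit.HubbardSuperconductivity.HubbardSuperconductivity.Theorems.TorusFourierL2

set_option linter.dupNamespace false -- summit = problem name (single-conjunct summit), D-0017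

open Set Finset Literature.MathematicalPhysics.QuantumLattice Literature.MathematicalPhysics.QuantumLattice.BandSectorCounting
open Literature.MathematicalPhysics.QuantumLattice.FermiRG Literature.Probability.LatticeModels Literature.Analysis.SpecialFunctions
open Summit.HubbardSuperconductivity.HubbardSuperconductivity.Theorems.DispersionFlow
open Summit.HubbardSuperconductivity.HubbardSuperconductivity.Theorems.KLRegimeSplit
open Summit.HubbardSuperconductivity.HubbardSuperconductivity.Theorems.KLProgrammeLegKernels
open Summit.HubbardSuperconductivity.HubbardSuperconductivity.Theorems.PerturbedFermiCurve
open Summit.HubbardSuperconductivity.HubbardSuperconductivity.Theorems.EngineV8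
open Literature.Probability.LatticeModels.BattleFederbush
open scoped Real Nat

open Classical

/-- **The overlap base index below the deep window** (pure arithmetic): if `U ≤ 1`, `1 ≤ n` and `¬ 4ⁿ·U ≤ 4^{2K+5}`, then
`m₀ := Nat.findGreatest (fun m ↦ 4^m·U ≤ 4^{2K+5}) n` has `1 ≤ m₀ ≤ n`, `2K + 5 ≤ m₀` and `4^{m₀}·U ≤ 4^{2K+5}`. [folklore] -/
theorem exists_overlap_base_index_of_not_window {U : ℝ} (hU1 : U ≤ 1) {n K : ℕ} (hn : 1 ≤ n)
    (hwin : ¬ (4 : ℝ) ^ n * U ≤ (4 : ℝ) ^ (2 * K + 5)) :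
    ∃ m₀ : ℕ, 1 ≤ m₀ ∧ m₀ ≤ n ∧ 2 * K + 5 ≤ m₀ ∧ (4 : ℝ) ^ m₀ * U ≤ (4 : ℝ) ^ (2 * K + 5) := by
  set P : ℕ → Prop := fun m => (4 : ℝ) ^ m * U ≤ (4 : ℝ) ^ (2 * K + 5) with hP
  have hP1 : P 1 := by
    show (4 : ℝ) ^ 1 * U ≤ (4 : ℝ) ^ (2 * K + 5)
    calc (4 : ℝ) ^ 1 * U ≤ (4 : ℝ) ^ 1 * 1 := mul_le_mul_of_nonneg_left hU1 (by positivity)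
      _ ≤ (4 : ℝ) ^ (2 * K + 5) := by rw [mul_one]; exact pow_le_pow_right₀ (by norm_num) (by omega)
  refine ⟨Nat.findGreatest P n, Nat.le_findGreatest (P := P) hn hP1, Nat.findGreatest_le (P := P) n, ?_,
    Nat.findGreatest_spec (P := P) hn hP1⟩
  have hm₀n : Nat.findGreatest P n < n := by
    rcases (Nat.findGreatest_le (P := P) n).lt_or_eq with h | h
    · exact h
    · exact absurd (h ▸ Nat.findGreatest_spec (P := P) hn hP1 : P n) hwin
  have hnot : ¬ P (Nat.findGreatest P n + 1) := Nat.findGreatest_is_greatest (P := P) (Nat.lt_succ_self _) hm₀n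
  by_contra hlt
  refine hnot ?_
  show (4 : ℝ) ^ (Nat.findGreatest P n + 1) * U ≤ (4 : ℝ) ^ (2 * K + 5)
  calc (4 : ℝ) ^ (Nat.findGreatest P n + 1) * U ≤ (4 : ℝ) ^ (Nat.findGreatest P n + 1) * 1 := mul_le_mul_of_nonneg_left hU1 (by positivity)
    _ ≤ (4 : ℝ) ^ (2 * K + 5) := by rw [mul_one]; exact pow_le_pow_right₀ (by norm_num) (by omega)

set_option maxHeartbeats 1600000 in -- three large instantiations
/-- **The weighted overlap constants of `E(F_{dk}[K_n])·S(F̃_{dk−1}[K_n])` at the flow frame, NO depth window** (see the module docstring).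
[cite: BenfattoGiulianiMastropietro2006, §2.7 (2.71a), §2.8 (2.77), (2.82)–(2.83), §3 (3.2)–(3.8)] -/
theorem overlapWt_towerBlock_klEng_flow_all (d : ℕ) (R : RenConsts) (c'' : ℝ) (hc'' : 0 ≤ c'') :
    ∃ CJ : ℝ, 0 < CJ ∧
      ∀ (G : GeoConsts) (P : SplitConsts) (Q : EngConsts) (cc : ℝ), R.WF2 → 0 < cc → cc ≤ EngineV8.klEngC₃6 P R →
      ∀ μ ∈ klWindowC, ∀ U : ℝ, 0 < U → U ≤ min (EngineV8.klEngU₀3 P R cc) (1 / (R.Gfr 3 + 1)) → c'' * U ≤ 1 →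
      ∀ β : ℝ, klBetaMin ≤ β → β ≤ Real.exp (cc / U ^ 2) →
      ∀ (L M : ℕ) [NeZero L] [NeZero M], EngineV8.klEngL₃ β U ≤ L → EngineV8.klEngM₃ β U L ≤ M →
      ∀ n : ℕ, 1 ≤ n → n ≤ nScales β + 1 → IsKLRegime U cc (-(n : ℤ)) → HistP klPredsV17F2 L M G P Q R β U μ 0 n →
        (∀ m, 1 ≤ m → m < n → FlowPieceOscAt L M c'' β U μ m) →
        ∀ k : ℕ, 1 ≤ d * k → d * k ≤ n → ∀ jw : ℕ, d * k ≤ jw →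
        (∀ X'' : SpaceTimeIdx L M × SectorLeg (sectorCount (d * k)),
          ∑ X', ‖(sectorAnalysisMatrix L M β (klAnisoFamily L M β μ (klFlowFrameU L M β U μ n) klE0 (d * k)) *
            sectorSubMatrix L M β (bgmFatMultiplier L M klE0 β (nambuXiCT L μ (klFlowFrameU L M β U μ n)) (d * k - 1))) X'' X'‖ *
              EngineV8.klScaleWt L M β jw {EngineV8.latticeLegPos (2 * (2 * M)) X'', EngineV8.latticeLegPos (2 * (2 * M)) X'} ≤
            81 * CJ * M / β) ∧
        (∀ X' : SpaceTimeIdx L M × SectorLeg (sectorCount (d * k - 1)),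
          ∑ X'' : SpaceTimeIdx L M × SectorLeg (sectorCount (d * k)),
            ‖(sectorAnalysisMatrix L M β (klAnisoFamily L M β μ (klFlowFrameU L M β U μ n) klE0 (d * k)) *
              sectorSubMatrix L M β (bgmFatMultiplier L M klE0 β (nambuXiCT L μ (klFlowFrameU L M β U μ n)) (d * k - 1))) X'' X'‖ *
              EngineV8.klScaleWt L M β jw {EngineV8.latticeLegPos (2 * (2 * M)) X'', EngineV8.latticeLegPos (2 * (2 * M)) X'} ≤
            81 * (2 : ℝ) ^ (d * k - (d * k - 1)) * CJ * M / β) := by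
  have ha : (-4 : ℝ) < -(6 / 5) := by norm_num
  have hab : (-(6 / 5) : ℝ) ≤ -(1 / 10) := by norm_num
  have hb : (-(1 / 10) : ℝ) < 0 := by norm_num
  obtain ⟨Cr, hCr, hdeepR⟩ := overlapWt_towerBlock_klEng_flow_deep d 5
  obtain ⟨Cc, hCc, hdeepC⟩ := overlapWt_towerBlockCol_klEng_flow_deep d 5
  obtain ⟨Ct, hCt, htel⟩ := overlapWt_rows_cols_klEng_meanFreeFinal 5 R c'' hc''
  refine ⟨Cr + Cc + Ct, by positivity, ?_⟩
  intro G P Q cc hR2 hcc hcc6 μ hμ U hU hUle hcU β hβmin hβc L M _ _ hL3 hM3 n hn1 hnN hreg hhist hosc k hdk hkn jw hjw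
  have hRj : ∀ i, 0 ≤ R.Gfr i := EngineV8.gfr_nonneg_of_wf2 hR2
  have hU1 : U ≤ 1 :=
    ((hUle.trans (min_le_left _ _)).trans (EngineV8.klEngU₀3_le_symbolU₀ ha hab hb P hRj cc)).trans (min_le_left _ _)
  have hβ0 : 0 < β := pos_of_klBetaMin_le hβmin
  have hM0 : (0 : ℝ) < M := Nat.cast_pos.2 (Nat.pos_of_ne_zero (NeZero.ne M))
  have hMβ : 0 ≤ (M : ℝ) / β := by positivity
  have hfrac : ∀ {a b : ℝ}, a ≤ b → a * M / β ≤ b * M / β := fun h =>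
    div_le_div_of_nonneg_right (mul_le_mul_of_nonneg_right h hM0.le) hβ0.le
  have h2pos : 0 ≤ (2 : ℝ) ^ (d * k - (d * k - 1)) := by positivity
  have hmonoR : 81 * Cr * M / β ≤ 81 * (Cr + Cc + Ct) * M / β := hfrac (by linarith)
  have hmonoT : 81 * Ct * M / β ≤ 81 * (Cr + Cc + Ct) * M / β := hfrac (by linarith)
  have hmonoC : 81 * (2 : ℝ) ^ (d * k - (d * k - 1)) * Cc * M / β ≤ 81 * (2 : ℝ) ^ (d * k - (d * k - 1)) * (Cr + Cc + Ct) * M / β :=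
    hfrac (mul_le_mul_of_nonneg_left (by linarith) (by positivity))
  have hmonoTC : 162 * Ct * M / β ≤ 81 * (2 : ℝ) ^ (d * k - (d * k - 1)) * (Cr + Cc + Ct) * M / β := by
    refine hfrac ?_
    rw [show d * k - (d * k - 1) = 1 by omega, pow_one]
    linarith
  by_cases hwin : (4 : ℝ) ^ n * U ≤ (4 : ℝ) ^ (2 * (d * k) + 5)
  · -- on the deep window: p3's constants at `K_n`
    have hfr : FrameOK R U (nScales β) μ (klFlowFrameU L M β U μ n) := frameOK_klFlowFrameU_of_histP_le hR2 hn1 le_rfl hnN hhist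
    have hrow := (hdeepR G P R Q cc hR2 hcc hcc6 μ hμ U hU hUle β hβmin hβc L M hL3 hM3 n hn1 hnN hhist hfr k hdk (d * k) le_rfl hkn hwin jw hjw).1
    have hcol := hdeepC G P R Q cc hR2 hcc hcc6 μ hμ U hU hUle β hβmin hβc L M hL3 hM3 n hn1 hnN hhist hfr k hdk (d * k) le_rfl hkn hwin jw hjw
    exact ⟨fun X'' => (hrow X'').trans hmonoR, fun X' => (hcol X').trans hmonoC⟩
  · -- below it: the (W4) telescope from the base index `m₀`, read at `K_n` through the model congruence, at the weaker rate `jw`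
    obtain ⟨m₀, hm1, hmn, hdepth, hwin₀⟩ := exists_overlap_base_index_of_not_window hU1 hn1 hwin
    have e1 : d * k - 1 + 1 = d * k := by omega
    have h := htel G P Q cc hR2 hcc hcc6 μ hμ U hU hUle hcU β hβmin hβc L M hL3 hM3 n hnN hreg hhist hosc m₀ hm1 hmn (d * k - 1)
      (by rw [e1]; exact hdepth) (by rw [e1]; exact hwin₀)
    rw [e1] at h
    obtain ⟨hrow, hcol⟩ := h
    have hK : ∀ q : TorusSite 2 L,
        (fsub (klFlowFrameU L M β U μ n) (symInterp L fun _ =>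
            ∑ m ∈ Ico n n, klAngularMean (klLocalPart L M β U μ (klFlowFrameU L M β U μ m) m))).eval (latticeMomentum L q) =
          (klFlowFrameU L M β U μ n).eval (latticeMomentum L q) := fun q =>
      eval_fsub_symInterp_sum_Ico_self _ _ n _
    have hxi := nambuXiCT_congr L μ hK
    have hfam := klAnisoFamily_congr L M hK β μ klE0 (d * k)
    rw [hxi, hfam] at hrow hcol
    -- the weaker rate
    have hwt : ∀ S : Finset (ZMod (2 * (2 * M)) × TorusSite 2 L), EngineV8.klScaleWt L M β jw S ≤ EngineV8.klScaleWt L M β (d * k) S :=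
      fun S => klScaleWt_le_of_le β hjw S
    refine ⟨fun X'' => ?_, fun X' => ?_⟩
    · refine le_trans (Finset.sum_le_sum fun X' _ => mul_le_mul_of_nonneg_left (hwt _) (norm_nonneg _)) ((hrow X'').trans hmonoT)
    · refine le_trans (Finset.sum_le_sum fun X'' _ => mul_le_mul_of_nonneg_left (hwt _) (norm_nonneg _)) ((hcol X').trans hmonoTC)

end Summit.HubbardSuperconductivity.HubbardSuperconductivity.Theorems.TorusFourierL2

end
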